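import Summits.Ventures.Crystal3D.Theorems.StickyWulffConstantGenericWallFloorStackLedgerLocalTools
import HarnessLib

/-!
# The FORCED RAY of a stack walker: a sound well-formed stack is determined by its depth and its first push normal

HONEST FRAMING. Part of the venture `Summits/Ventures/Crystal3D` (cell `crystal3d-full`), helper `--supports` the
crux `GenericWallFloor` (stmt-Ventures-19480) of `route-Ventures-StickyWulffConstant`, registered line `WallLedgerG`,
open stub `stub_twoSlabAdhesion` (general fillings).  The localised stack ledger (`…StackLedgerLocal`) is residual-free
for NON-CHAIN pairs: it keeps the walkers' frames inside two mirror-closed families and uses the families for exactly two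
things — the end balls stay off the far clamped sample, and cross-grain end states at one ball have non-co-axial top
lattices.  Both only need to know WHICH FRAMES A WALKER CAN CARRY, and that set is far smaller than a mirror-closed
family: it is a RAY.

**Static structure theorem (`entries_forced`).**  Let a stack `e :: rest` be sound (`StackSound z`), well formed
(`StackWF z`) and have bottom `⟨A, u, 0⟩`.  Then every non-bottom entry is `forcedTop z ⟨A, u, 0⟩ n k` for ONE unit
menu normal `n` of `A` with `⟪A u, n⟫ = √(2/3)` (the first push normal — one of the two positive `{111}` normals of the
steep slot) and its level `k`:  level `0` is the push entry `(R_n A, bestCapper, n)`, and level `k + 1` is the push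
entry of level `k` through the FORCED normal `2√(2/3)·F_k d_k − n_k` — the only other menu normal making the direction
`d_k` positive (`menu_normal_eq_or_eq_twin`; the entry's own normal is excluded by `StackWF`, which POPs instead).
Hence (`frame_mem_chainFrames_of_stack`) every frame on such a stack lies in the countable set
`chainFrames z A u = {A} ∪ {frames of the two forced rays}`.

Used by `…StackLedgerLocalSep` / `…StackLedgerLocalChain`: the residual-free ledger for EVERY pair whose two forced
rays (grain 1 upward, grain 2 downward) are pairwise non-co-axial — all non-chain pairs and all chain pairs whose
connecting twin path is not followed by the rays.

WHAT THIS IS NOT: not the stub; no counting here; F-C1 not moved.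
-/

noncomputable section

namespace Summit.Ventures.Crystal3D.Theorems

open Summit.Ventures.Crystal3D Finset
open Literature.MathematicalPhysics.StatisticalMechanics (fccStacking)
open scoped InnerProductSpace

/-! ### The forced ray -/

/-- The PUSH ENTRY of the entry `e` through the unit normal `n` for the vertical `z`: the twin frame `R_n ∘ F`,
its best-rising capper, and `n` as entry normal (the new top after a PUSH of the stack walk). -/
def pushEntry (z : EuclideanSpace ℝ (Fin 3)) (e : WalkEntry) (n : EuclideanSpace ℝ (Fin 3)) : WalkEntry :=
  ⟨twinFrame e.frame n, bestCapper (twinFrame e.frame n) n z, n⟩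

/-- The FORCED NEXT NORMAL of a (non-bottom) entry: the mirror image `2√(2/3)·F d − n` of its entry normal through
its direction — the only other `{111}` normal of the frame making the direction positive. -/
def nextNormal (e : WalkEntry) : EuclideanSpace ℝ (Fin 3) :=
  (2 * Real.sqrt (2 / 3)) • e.frame e.dir - e.nrm

/-- The FORCED RAY over the bottom entry `b` with first push normal `n`: level `0` is the push entry of `b`
through `n`, level `k + 1` the push entry of level `k` through its forced next normal. -/
def forcedTop (z : EuclideanSpace ℝ (Fin 3)) (b : WalkEntry) (n : EuclideanSpace ℝ (Fin 3)) : ℕ → WalkEntry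
  | 0 => pushEntry z b n
  | k + 1 => pushEntry z (forcedTop z b n k) (nextNormal (forcedTop z b n k))

/-- The CHAIN FRAMES of the grain `(A, u)` for the vertical `z`: the frame `A` itself and the frames of the two
forced rays (one for each unit menu normal `n` of `A` with `⟪A u, n⟫ = √(2/3)`).  Every frame a stack walker of
this grain can carry lies here (`frame_mem_chainFrames_of_stack`). -/
def chainFrames (z : EuclideanSpace ℝ (Fin 3)) (A : EuclideanSpace ℝ (Fin 3) ≃ₗᵢ[ℝ] EuclideanSpace ℝ (Fin 3))
    (u : EuclideanSpace ℝ (Fin 3)) : Set (EuclideanSpace ℝ (Fin 3) ≃ₗᵢ[ℝ] EuclideanSpace ℝ (Fin 3)) :=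
  {F | F = A ∨ ∃ n : EuclideanSpace ℝ (Fin 3), ‖n‖ = 1 ∧
    (∀ w ∈ fccSlots, ⟪A w, n⟫_ℝ = 0 ∨ ⟪A w, n⟫_ℝ = Real.sqrt (2 / 3) ∨ ⟪A w, n⟫_ℝ = -Real.sqrt (2 / 3)) ∧
    ⟪A u, n⟫_ℝ = Real.sqrt (2 / 3) ∧ ∃ k : ℕ, F = (forcedTop z ⟨A, u, 0⟩ n k).frame}

/-- The base frame is a chain frame. -/
theorem self_mem_chainFrames (z : EuclideanSpace ℝ (Fin 3))
    (A : EuclideanSpace ℝ (Fin 3) ≃ₗᵢ[ℝ] EuclideanSpace ℝ (Fin 3)) (u : EuclideanSpace ℝ (Fin 3)) :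
    A ∈ chainFrames z A u :=
  Or.inl rfl

/-- Unfolding the ray, level `0`. -/
@[simp] theorem forcedTop_zero (z : EuclideanSpace ℝ (Fin 3)) (b : WalkEntry) (n : EuclideanSpace ℝ (Fin 3)) :
    forcedTop z b n 0 = pushEntry z b n := rfl

/-- Unfolding the ray, level `k + 1`. -/
@[simp] theorem forcedTop_succ (z : EuclideanSpace ℝ (Fin 3)) (b : WalkEntry) (n : EuclideanSpace ℝ (Fin 3)) (k : ℕ) :
    forcedTop z b n (k + 1) = pushEntry z (forcedTop z b n k) (nextNormal (forcedTop z b n k)) := rfl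

/-- The entry normal of a ray entry: `n` at level `0`, the forced next normal above. -/
theorem forcedTop_nrm_zero (z : EuclideanSpace ℝ (Fin 3)) (b : WalkEntry) (n : EuclideanSpace ℝ (Fin 3)) :
    (forcedTop z b n 0).nrm = n := rfl

/-! ### The structure theorem -/

/-- **The head of a sound well-formed stack is a push entry.**  If `e` is sound, linked to `e'` and has the best
capper (for its own entry normal) as direction, then `e` is the push entry of `e'` through `e.nrm`. -/
theorem head_eq_pushEntry {z : EuclideanSpace ℝ (Fin 3)} {e e' : WalkEntry} (hSo : e.Sound z) (hLi : e.Link e')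
    (hdir : e.dir = bestCapper e.frame e.nrm z) :
    e = pushEntry z e' e.nrm := by
  obtain ⟨-, hn, -, -, -, -, -⟩ := hSo
  have hfr : e.frame = twinFrame e'.frame e.nrm := frame_eq_twinFrame_of_link hn hLi
  refine WalkEntry.eq_of_parts hfr ?_ rfl
  show e.dir = bestCapper (twinFrame e'.frame e.nrm) e.nrm z
  rw [← hfr]; exact hdir

/-- The entry normal of a sound entry linked to a SOUND lower entry with a different normal is the lower entry's
forced next normal. -/
theorem nrm_eq_nextNormal {z : EuclideanSpace ℝ (Fin 3)} {e e' : WalkEntry} (hSo : e.Sound z) (hLi : e.Link e')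
    (hSo' : e'.Sound z) (hne : e.nrm ≠ e'.nrm) : e.nrm = nextNormal e' := by
  obtain ⟨-, hn, hmenu, -, -, -, -⟩ := hSo
  obtain ⟨hdir', hn', hmenu', hpos', -, -, -⟩ := hSo'
  have hc : ‖e'.frame e'.dir‖ = 1 := by rw [LinearIsometryEquiv.norm_map, norm_eq_one_of_mem_fccSlots hdir']
  -- `e.nrm` is a menu normal of the lower frame too (the menu survives the twin reflection)
  have hback : ∀ x, e'.frame x = e.frame x - (2 * ⟪e.frame x, e.nrm⟫_ℝ) • e.nrm := twin_symm e'.frame e.frame hn hLi.1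
  have hmenu_e' : ∀ w ∈ fccSlots, ⟪e'.frame w, e.nrm⟫_ℝ = 0 ∨ ⟪e'.frame w, e.nrm⟫_ℝ = Real.sqrt (2 / 3) ∨
      ⟪e'.frame w, e.nrm⟫_ℝ = -Real.sqrt (2 / 3) := menu_reflect e.frame e'.frame hn hmenu hback
  rcases menu_normal_eq_or_eq_twin e'.frame hn' hn hc hmenu' hmenu_e' hpos' hLi.2 with h | h
  · exact absurd h hne
  · exact h

/-- **Structure theorem.**  Every entry of a sound, well-formed stack with bottom `⟨A, u, 0⟩` is the bottom or a
ray entry `forcedTop z ⟨A, u, 0⟩ n k` for a unit menu normal `n` of `A` with `⟪A u, n⟫ = √(2/3)`. -/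
theorem entries_forced {z : EuclideanSpace ℝ (Fin 3)} {A : EuclideanSpace ℝ (Fin 3) ≃ₗᵢ[ℝ] EuclideanSpace ℝ (Fin 3)}
    {u : EuclideanSpace ℝ (Fin 3)} :
    ∀ (rest : List WalkEntry) (e : WalkEntry), StackSound z (e :: rest) → StackWF z (e :: rest) →
      (e :: rest).getLast? = some ⟨A, u, 0⟩ →
      ∀ e₀ ∈ e :: rest, e₀ = ⟨A, u, 0⟩ ∨ ∃ n : EuclideanSpace ℝ (Fin 3), ‖n‖ = 1 ∧
        (∀ w ∈ fccSlots, ⟪A w, n⟫_ℝ = 0 ∨ ⟪A w, n⟫_ℝ = Real.sqrt (2 / 3) ∨ ⟪A w, n⟫_ℝ = -Real.sqrt (2 / 3)) ∧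
        ⟪A u, n⟫_ℝ = Real.sqrt (2 / 3) ∧ ∃ k : ℕ, e₀ = forcedTop z ⟨A, u, 0⟩ n k
  | [], e, _, _, hlast, e₀, he₀ => by
    rw [List.mem_singleton] at he₀
    rw [List.getLast?_singleton] at hlast
    exact Or.inl (he₀.trans (Option.some.inj hlast))
  | e' :: rest', e, hS, hW, hlast, e₀, he₀ => by
    obtain ⟨hSo, hLi, hS'⟩ := hS
    obtain ⟨hdir, hne, hW'⟩ := (stackWF_cons_cons z e e' rest').1 hW
    have hlast' : (e' :: rest').getLast? = some ⟨A, u, 0⟩ := by rw [← hlast, List.getLast?_cons_cons]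
    have htail := entries_forced rest' e' hS' hW' hlast'
    rcases List.mem_cons.1 he₀ with rfl | hmem
    swap
    · exact htail e₀ hmem
    -- the head
    right
    have hpush := head_eq_pushEntry hSo hLi hdir
    have hn : ‖e₀.nrm‖ = 1 := hSo.2.1
    have hmenu := hSo.2.2.1
    by_cases hb : e' = ⟨A, u, 0⟩
    · -- the lower entry is the bottom: `e₀` is the first push entry, `e₀.nrm` the first push normal
      subst hb
      refine ⟨e₀.nrm, hn, ?_, hLi.2, 0, ?_⟩
      · have hback : ∀ x, A x = e₀.frame x - (2 * ⟪e₀.frame x, e₀.nrm⟫_ℝ) • e₀.nrm :=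
          twin_symm (A : EuclideanSpace ℝ (Fin 3) ≃ₗᵢ[ℝ] EuclideanSpace ℝ (Fin 3)) e₀.frame hn hLi.1
        exact menu_reflect e₀.frame A hn hmenu hback
      · rw [forcedTop_zero]; exact hpush
    · -- the lower entry is a ray entry, and it is sound (it is not the bottom, so the stack continues below it)
      rcases htail e' (List.mem_cons_self) with h | ⟨n, hn₁, hmenu₁, hpos₁, k, hk⟩
      · exact absurd h hb
      refine ⟨n, hn₁, hmenu₁, hpos₁, k + 1, ?_⟩
      cases rest' with
      | nil =>
        rw [List.getLast?_singleton] at hlast'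
        exact absurd (Option.some.inj hlast') hb
      | cons e'' rest'' =>
        have hSo' : e'.Sound z := hS'.1
        rw [forcedTop_succ, ← hk, ← nrm_eq_nextNormal hSo hLi hSo' hne]
        exact hpush

/-- **Every frame on a sound, well-formed stack with bottom `⟨A, u, 0⟩` is a chain frame of `(A, u)`.** -/
theorem frame_mem_chainFrames_of_stack {z : EuclideanSpace ℝ (Fin 3)}
    {A : EuclideanSpace ℝ (Fin 3) ≃ₗᵢ[ℝ] EuclideanSpace ℝ (Fin 3)} {u : EuclideanSpace ℝ (Fin 3)}
    {stk : List WalkEntry} (hS : StackSound z stk) (hW : StackWF z stk) (hlast : stk.getLast? = some ⟨A, u, 0⟩) :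
    ∀ e ∈ stk, e.frame ∈ chainFrames z A u := by
  intro e he
  cases stk with
  | nil => simp at he
  | cons e₁ rest =>
    rcases entries_forced rest e₁ hS hW hlast e he with h | ⟨n, hn, hmenu, hpos, k, hk⟩
    · exact Or.inl (by rw [h])
    · exact Or.inr ⟨n, hn, hmenu, hpos, k, by rw [hk]⟩

end Summit.Ventures.Crystal3D.Theorems

end
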